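import Summits.Ventures.HSemireg.WedgeHankelRecurrenceGaussChebyshevMixedResultant

/-!
# Venture HSemireg — **`T_{kn}` ON THE GAUSS–CHEBYSHEV NODES OF ORDER `n` AND THE RESULTANT `Res(T_{kn}, T_n)`** (Mathlib's Chebyshev polynomials): from `T_{kn} = T_k ∘ T_n` (Mathlib `T_mul`)
# and `X ∣ T_k − T_k(0)`: **`T_{kn} = T_k(0) + T_n · g(T_n)`**, so `T_{kn} ≡ T_k(0)` on the zeros of `T_n`, **`T_n ∣ T_{kn} − T_k(0)`** (any commutative ring; `T_n ∣ T_{kn}` for odd `k`,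
# `T_n ∣ T_{2n} + 1`), and over `ℤ` **`Res_{(k(n+1), n+1)}(T_{k(n+1)}, T_{n+1}) = (−1)^{k(n+1)(n+1)} (2^n)^{k(n+1)} T_k(0)^{n+1}`** — zero for odd `k`, `(−1)^{n+1} 4^{n(n+1)}` for `k = 2`

HONEST FRAMING. Part of the Lean index of the computation cell `pub-hsemireg` (seat p10 gen 47, Sunday typer «UNIFORM-IN-n»).  Polynomial algebra only (Mathlib `Polynomial.Chebyshev`,
`Polynomial.resultant`); no variety, no cohomology theory, no sheaf, no Ext group and no semiregularity map is constructed here; nothing here says that HC / HC_CM / HC_AV holds; no Literature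
fact (unproved `Prop`) is declared or used.  Custodian versions as in `WedgeHankelSiegelIdeal` (1/3).
SOURCES (cited).  K. Dilcher, K. B. Stolarsky, *Resultants and discriminants of Chebyshev and related polynomials*, Trans. Amer. Math. Soc. 357 (2005) 965–981, Thm 2 (`Res(T_m, T_n)` in general;
here the case `n ∣ m`); T. J. Rivlin, *Chebyshev Polynomials* (2nd ed., 1990), §1.2 (semigroup property `T_m ∘ T_n = T_{mn}`), Ex. 1.5 (divisibility `T_n ∣ T_{(2l+1)n}`).  The displayed
resultant is the COROLLARY typed here.
PROOF TYPED HERE.  Mathlib `T_mul` (`T_{kn} = T_k.comp T_n`), `X_dvd_sub_C`; `resultant_add_mul_left` (degree of `g ∘ T_{n+1}` at most `(k−1)(n+1)`), `resultant_C_left`; N406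
`chebyshevT_natDegree_coeff`.
DEDUP DISCLOSURE (`rg -n -i 'T_mul_decomp|dvd_T_mul|resultant_T_mul' Summits/Ventures/HSemireg`, 2026-09-04): nothing; Mathlib has `T_mul` itself (used); 0 hits for the 8 names below.

WHAT IS IN THE TREE.  N406 `chebyshevT_natDegree_coeff`; Mathlib `T_mul`, `X_dvd_sub_C`, `resultant_C_left`, `resultant_add_mul_left`, `natDegree_comp_le`, `T_eval_zero_of_odd`, `T_two`.
THIS FILE (namespace `Summit.Ventures.HSemireg.Wedge.HankelOuter` continued; CHAINED on N432; 0 definitions):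
* §1198 `chebyshevT_mul_decomp` (`∃ g, T_k = C(T_k(0)) + X g ∧ T_{kn} = C(T_k(0)) + T_n · g.comp T_n`), `chebyshevT_eval_T_mul_of_eval_eq_zero`, **`chebyshevT_dvd_T_mul_sub_C`**,
  `chebyshevT_dvd_T_odd_mul`, `chebyshevT_dvd_T_two_mul_add_one`, **`chebyshevT_resultant_T_mul`**, `chebyshevT_resultant_T_odd_mul` (`= 0`), `chebyshevT_resultant_T_two_mul`
  (`= (−1)^{n+1} 4^{n(n+1)}`).
CAVEATS.  Resultants over `ℤ` with formal degrees explicit and the inner index written `n + 1`.  Nothing Ext-side.  New names only.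
-/

open Module Polynomial
open scoped Matrix Polynomial

namespace Summit.Ventures.HSemireg.Wedge.HankelOuter

/-! ## §1198. `T_{kn} = T_k ∘ T_n` against `T_n` -/

/-- **`T_k = T_k(0) + X·g` and `T_{kn} = T_k(0) + T_n · g(T_n)`** for some polynomial `g` (any commutative ring). [Rivlin §1.2; this file, §1198] -/
theorem chebyshevT_mul_decomp {R : Type*} [CommRing R] (k n : ℤ) :
    ∃ g : R[X], Polynomial.Chebyshev.T R k = C ((Polynomial.Chebyshev.T R k).eval 0) + Polynomial.X * g ∧
      Polynomial.Chebyshev.T R (k * n) = C ((Polynomial.Chebyshev.T R k).eval 0) + Polynomial.Chebyshev.T R n * g.comp (Polynomial.Chebyshev.T R n) := by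
  obtain ⟨g, hg⟩ := X_dvd_sub_C (p := Polynomial.Chebyshev.T R k)
  rw [coeff_zero_eq_eval_zero, sub_eq_iff_eq_add'] at hg
  refine ⟨g, hg, ?_⟩
  rw [Polynomial.Chebyshev.T_mul]
  conv_lhs => rw [hg]
  rw [add_comp, C_comp, mul_comp, X_comp]

/-- **On a zero `x` of `T_n`, `T_{kn}(x) = T_k(0)`** (any commutative ring). [Rivlin §1.2; this file, §1198] -/
theorem chebyshevT_eval_T_mul_of_eval_eq_zero {R : Type*} [CommRing R] (k n : ℤ) {x : R} (hx : (Polynomial.Chebyshev.T R n).eval x = 0) :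
    (Polynomial.Chebyshev.T R (k * n)).eval x = (Polynomial.Chebyshev.T R k).eval 0 := by
  rw [Polynomial.Chebyshev.T_mul, eval_comp, hx]

/-- **`T_n ∣ T_{kn} − T_k(0)`** (any commutative ring). [Rivlin Ex. 1.5; this file, §1198] -/
theorem chebyshevT_dvd_T_mul_sub_C {R : Type*} [CommRing R] (k n : ℤ) :
    Polynomial.Chebyshev.T R n ∣ Polynomial.Chebyshev.T R (k * n) - C ((Polynomial.Chebyshev.T R k).eval 0) := by
  obtain ⟨g, -, hg⟩ := chebyshevT_mul_decomp (R := R) k n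
  exact ⟨g.comp (Polynomial.Chebyshev.T R n), by rw [hg]; ring⟩

/-- **`T_n ∣ T_{kn}` for odd `k`.** [Rivlin Ex. 1.5; this file, §1198] -/
theorem chebyshevT_dvd_T_odd_mul {R : Type*} [CommRing R] {k : ℤ} (hk : Odd k) (n : ℤ) :
    Polynomial.Chebyshev.T R n ∣ Polynomial.Chebyshev.T R (k * n) := by
  have h := chebyshevT_dvd_T_mul_sub_C (R := R) k n
  rwa [Polynomial.Chebyshev.T_eval_zero_of_odd R hk, map_zero, sub_zero] at h

/-- **`T_n ∣ T_{2n} + 1`.** [Rivlin §1.2 (`T_{2n} = 2T_n² − 1`); this file, §1198] -/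
theorem chebyshevT_dvd_T_two_mul_add_one {R : Type*} [CommRing R] (n : ℤ) :
    Polynomial.Chebyshev.T R n ∣ Polynomial.Chebyshev.T R (2 * n) + 1 := by
  have h := chebyshevT_dvd_T_mul_sub_C (R := R) 2 n
  have h2 : (Polynomial.Chebyshev.T R 2).eval 0 = -1 := by norm_num [Polynomial.Chebyshev.T_two]
  rwa [h2, map_neg, map_one, sub_neg_eq_add] at h

/-- **`Res_{(k(n+1), n+1)}(T_{k(n+1)}, T_{n+1}) = (−1)^{k(n+1)(n+1)} (2^n)^{k(n+1)} T_k(0)^{n+1}`** over `ℤ`. [Dilcher–Stolarsky 2005 Thm 2 (case `n ∣ m`); this file, §1198] -/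
theorem chebyshevT_resultant_T_mul (k n : ℕ) :
    (Polynomial.Chebyshev.T ℤ ((k : ℤ) * ((n : ℤ) + 1))).resultant (Polynomial.Chebyshev.T ℤ ((n : ℤ) + 1)) (k * (n + 1)) (n + 1) =
      (-1) ^ (k * (n + 1) * (n + 1)) * (2 ^ n) ^ (k * (n + 1)) * ((Polynomial.Chebyshev.T ℤ (k : ℤ)).eval 0) ^ (n + 1) := by
  obtain ⟨hd, hc⟩ := chebyshevT_natDegree_coeff n
  cases k with
  | zero => simp [Polynomial.Chebyshev.T_zero]
  | succ j =>
    obtain ⟨g, hg1, hg2⟩ := chebyshevT_mul_decomp (R := ℤ) ((j + 1 : ℕ) : ℤ) ((n : ℤ) + 1)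
    obtain ⟨hdj, -⟩ := chebyshevT_natDegree_coeff j
    -- `deg g ≤ j`
    have hgj : g.natDegree ≤ j := by
      by_cases hg0 : g = 0
      · rw [hg0, natDegree_zero]; exact Nat.zero_le _
      have hXg : Polynomial.X * g = Polynomial.Chebyshev.T ℤ ((j : ℤ) + 1) - C ((Polynomial.Chebyshev.T ℤ ((j + 1 : ℕ) : ℤ)).eval 0) := by
        rw [eq_sub_iff_add_eq', ← hg1]; push_cast; rfl
      have h1 := natDegree_X_mul hg0
      rw [hXg] at h1
      have h2 := (natDegree_sub_le (Polynomial.Chebyshev.T ℤ ((j : ℤ) + 1)) (C ((Polynomial.Chebyshev.T ℤ ((j + 1 : ℕ) : ℤ)).eval 0))).trans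
        (max_le hdj.le (by rw [natDegree_C]; exact Nat.zero_le _))
      omega
    have hgd : (g.comp (Polynomial.Chebyshev.T ℤ ((n : ℤ) + 1))).natDegree + (n + 1) ≤ (j + 1) * (n + 1) := by
      have h1 := natDegree_comp_le (p := g) (q := Polynomial.Chebyshev.T ℤ ((n : ℤ) + 1))
      rw [hd] at h1
      have h2 := Nat.mul_le_mul_right (n + 1) hgj
      rw [Nat.succ_mul]
      omega
    rw [hg2, resultant_add_mul_left _ _ _ _ _ hgd hd.le, resultant_C_left, hc]

/-- **Odd `k`: `Res_{(k(n+1), n+1)}(T_{k(n+1)}, T_{n+1}) = 0`** (`T_{n+1} ∣ T_{k(n+1)}`). [corollary; this file, §1198] -/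
theorem chebyshevT_resultant_T_odd_mul {k : ℕ} (hk : Odd k) (n : ℕ) :
    (Polynomial.Chebyshev.T ℤ ((k : ℤ) * ((n : ℤ) + 1))).resultant (Polynomial.Chebyshev.T ℤ ((n : ℤ) + 1)) (k * (n + 1)) (n + 1) = 0 := by
  rw [chebyshevT_resultant_T_mul, Polynomial.Chebyshev.T_eval_zero_of_odd ℤ (Odd.natCast hk), zero_pow (Nat.succ_ne_zero n), mul_zero]

/-- **`k = 2`: `Res_{(2(n+1), n+1)}(T_{2(n+1)}, T_{n+1}) = (−1)^{n+1} 4^{n(n+1)}`.** [corollary; Dilcher–Stolarsky 2005; this file, §1198] -/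
theorem chebyshevT_resultant_T_two_mul (n : ℕ) :
    (Polynomial.Chebyshev.T ℤ (2 * ((n : ℤ) + 1))).resultant (Polynomial.Chebyshev.T ℤ ((n : ℤ) + 1)) (2 * (n + 1)) (n + 1) = (-1) ^ (n + 1) * 4 ^ (n * (n + 1)) := by
  have h := chebyshevT_resultant_T_mul 2 n
  push_cast at h
  have h2 : (Polynomial.Chebyshev.T ℤ 2).eval 0 = -1 := by norm_num [Polynomial.Chebyshev.T_two]
  have h4 : ((2 : ℤ) ^ n) ^ (2 * (n + 1)) = 4 ^ (n * (n + 1)) := by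
    rw [← pow_mul, show n * (2 * (n + 1)) = 2 * (n * (n + 1)) by ring, pow_mul]; norm_num
  rw [h, h2, h4, Even.neg_one_pow (show Even (2 * (n + 1) * (n + 1)) from ⟨(n + 1) * (n + 1), by ring⟩), one_mul, mul_comm]

end Summit.Ventures.HSemireg.Wedge.HankelOuter
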